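import Literature.MathematicalPhysics.QuantumFieldTheory.QuasiLocalGaugePerturbationLocality
import Literature.Probability.LatticeModels.GibbsSpecificationTiltedRatio
import Literature.MathematicalPhysics.QuantumLattice.TorusWilsonGibbs
import HarnessLib

/-!
# Quasi-local gauge-invariant perturbations, IV: the DLR kernels of the perturbed torus measure

The perturbed torus measure `μ_{β,W} ∝ e^{-β S_W - W} ∏ₑ dU_e` of a quasi-local gauge-invariant
perturbation `W` (tree `QuasiLocalGaugePerturbation.perturbedMeasure`) is the full-volume kernel of
the Gibbsian specification with a priori measure Haar and volume-independent energy
`Φ = -β S_W - W.total`,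
`γ_Λ(· | ζ) = ((Haar^{⊗Λ}) ∘ glueWith⁻¹(·, ζ)).tilted Φ`
(the shape of `GibbsSpecificationTilted.lean`; at `W = 0` the torus Wilson kernels of
`TorusWilsonGibbs.lean`). This file proves the three kernel facts consumed by block-scale cluster
expansions around such measures (Georgii 2011, Def. 1.23 / Def. 2.9 and Ch. 8; Friedli–Velenik
2017, §6.3–§6.4, §6.10.1; Bałaban, CMP 119 (1988) p. 259–261 for the format of `W`):

## Main results (theorems only: no definition, no named fact)

* `QuasiLocalGaugePerturbation.perturbedMeasure_eq_tilted` — `μ_{β,W} = (Haar^{⊗ links}).tilted Φ`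
  (`Z_{β,W} ∈ (0, ∞)`); `….isSpecification_and_isGibbsMeasure_perturbedMeasure` — **DLR**: the
  kernels form a specification (tree `isSpecification_tilted_map_glueWith_pi`: finite link set,
  measurable singletons) and `μ_{β,W}` is a Gibbs measure for it
  (`IsSpecification.isGibbsMeasure_univ`, `map_glueWith_univ_pi`).
* `….integral_kernel_le_exp_mul_of_normLE_sub` — **two-sided density continuity in `W`**:
  `‖W - W'‖_{b,κ} ≤ δ`, `κ ≥ 0` ⇒ for the same exterior and every `[0,1]`-valued measurable `f`,
  on a region `Λ` of links of the blocks `R ⊆ blockCorners b`,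
  `γ^{W}_Λ f ≤ e^{2δ|R|} γ^{W'}_Λ f` and conversely (two tilts of one glued product Haar measure by
  energies differing by `(W' - W).total`, which oscillates by `≤ δ|R|` in the glued variables).
* `….integral_kernel_le_exp_mul_of_exterior_eq` — **quasi-locality in the exterior**:
  `‖W‖_{b,κ} ≤ η` (`κ ≥ 0`), range control, `b ≥ 1`, exteriors `ζ, ζ'` agreeing on every link whose
  block is `(m+1)`-near `R`, `f` reading only links of `Λ` and links where `ζ = ζ'` ⇒
  `γ_Λ(f | ζ) ≤ exp(4 η e^{-κ m} |R|) γ_Λ(f | ζ')` (the Wilson parts of the pulled-back energies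
  differ by a constant, the `W`-parts by a constant up to `2 η e^{-κ(m+2)} |R|`).

## References

* H.-O. Georgii, *Gibbs Measures and Phase Transitions*, 2nd ed. (2011), Def. 1.23, Def. 2.9,
  Ch. 8. [Georgii2011]
* S. Friedli, Y. Velenik, *Statistical Mechanics of Lattice Systems* (CUP 2017), §6.3, §6.10.1.
  [FriedliVelenik2017]
* T. Bałaban, CMP 119 (1988) 243–285, p. 259 (2.25)–(2.28), p. 261 (2.42). [Balaban1988Convergent]
-/

noncomputable section

open MeasureTheory Finset
open Literature.Probability.LatticeModels (glueWith glueWith_apply_mem glueWith_apply_not_mem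
  IsSpecification IsGibbsMeasure isSpecification_tilted_map_glueWith_pi
  integral_glued_tilted_le_exp_mul integrable_exp_of_abs_le)
open Literature.MathematicalPhysics.QuantumLattice (map_glueWith_univ_pi)

namespace Literature.MathematicalPhysics.QuantumFieldTheory

section Kernels

namespace QuasiLocalGaugePerturbation

variable {G : Type*} [Group G] [TopologicalSpace G] [IsTopologicalGroup G] [CompactSpace G]
  [MeasurableSpace G] [BorelSpace G] [SecondCountableTopology G] {N : ℕ}
  (ρ : G →* Matrix (Fin N) (Fin N) ℂ) (hρ : Continuous ρ) {d Lt : ℕ} [NeZero Lt] {b : ℕ}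

include hρ

omit [CompactSpace G] in
/-- The full action `-β S_W - W` is measurable (continuous `ρ`, second-countable `G`). [folklore] -/
theorem measurable_action (β : ℝ) (W : QuasiLocalGaugePerturbation d Lt G b) :
    Measurable fun U : GaugeConfig d Lt G => -β * wilsonAction ρ U - W.total U :=
  ((measurable_wilsonAction ρ hρ).const_mul _).sub W.measurable_total

omit [MeasurableSpace G] [BorelSpace G] [SecondCountableTopology G] [IsTopologicalGroup G] in
/-- The full action `-β S_W - W` is bounded (compact `G`). [folklore] -/
theorem exists_abs_action_le [MeasurableSpace G] (β : ℝ)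
    (W : QuasiLocalGaugePerturbation d Lt G b) :
    ∃ C, ∀ U : GaugeConfig d Lt G, |-β * wilsonAction ρ U - W.total U| ≤ C := by
  obtain ⟨B, hB⟩ := exists_abs_wilsonAction_le (d := d) (L := Lt) ρ hρ
  obtain ⟨C, hC⟩ := W.exists_abs_total_le
  refine ⟨|β| * B + C, fun U => (abs_sub _ _).trans (add_le_add ?_ (hC U))⟩
  rw [abs_mul, abs_neg]
  exact mul_le_mul_of_nonneg_left (hB U) (abs_nonneg _)

/-- **The perturbed torus measure is a tilt of product Haar**: `μ_{β,W} = (Haar^{⊗ links}).tilted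
(-β S_W - W)` (the normaliser `Z_{β,W} ∈ (0,∞)`, so no junk value is hit). [folklore] -/
theorem perturbedMeasure_eq_tilted (β : ℝ) (W : QuasiLocalGaugePerturbation d Lt G b) :
    W.perturbedMeasure ρ β = (Measure.pi fun _ : Edge d Lt => haarProbability G).tilted
      fun U => -β * wilsonAction ρ U - W.total U := by
  -- adapted from `wilsonMeasure_eq_tilted_pi` (TorusWilsonGibbs)
  set π : Measure (GaugeConfig d Lt G) := Measure.pi fun _ : Edge d Lt => haarProbability G with hπ
  haveI : IsProbabilityMeasure π := by rw [hπ]; infer_instance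
  have hint : Integrable (fun U => Real.exp (-β * wilsonAction ρ U - W.total U)) π :=
    integrable_exp_of_abs_le π (measurable_action ρ hρ β W) (exists_abs_action_le ρ hρ β W)
  have hZ : W.partitionFunction ρ β =
      ENNReal.ofReal (∫ U, Real.exp (-β * wilsonAction ρ U - W.total U) ∂π) := by
    rw [ofReal_integral_eq_lintegral_ofReal hint (ae_of_all _ fun U => (Real.exp_pos _).le)]
    simp only [QuasiLocalGaugePerturbation.partitionFunction, QuasiLocalGaugePerturbation.weight,
      withDensity_apply _ MeasurableSet.univ, Measure.restrict_univ, hπ]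
  have hZpos : 0 < ∫ U, Real.exp (-β * wilsonAction ρ U - W.total U) ∂π := integral_exp_pos hint
  have hdens : (fun U : GaugeConfig d Lt G => ENNReal.ofReal
      (Real.exp (-β * wilsonAction ρ U - W.total U) /
        ∫ V, Real.exp (-β * wilsonAction ρ V - W.total V) ∂π)) =
      (ENNReal.ofReal (∫ V, Real.exp (-β * wilsonAction ρ V - W.total V) ∂π))⁻¹ •
        fun U => ENNReal.ofReal (Real.exp (-β * wilsonAction ρ U - W.total U)) := by
    funext U
    simp only [Pi.smul_apply, smul_eq_mul]
    rw [div_eq_mul_inv, ENNReal.ofReal_mul (Real.exp_pos _).le, ENNReal.ofReal_inv_of_pos hZpos,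
      mul_comm]
  rw [Measure.tilted, hdens, withDensity_smul' _ _
      (ENNReal.inv_ne_top.2 (ENNReal.ofReal_pos.2 hZpos).ne'),
    QuasiLocalGaugePerturbation.perturbedMeasure, hZ, QuasiLocalGaugePerturbation.weight]

/-- **DLR for the perturbed torus measure**: the perturbed kernels
`((Haar^{⊗Λ}) ∘ glue(·,ζ)⁻¹).tilted (-β S_W - W)` form a specification in Georgii's sense
(probability, `𝓕_{Λᶜ}`-measurability, properness, consistency — the tree's
`isSpecification_tilted_map_glueWith_pi` with a volume-independent bounded measurable energy;
finite link set, measurable singletons), and `μ_{β,W}`, being the full-volume kernel, is a Gibbs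
measure for it (Georgii 2011, Def. 1.23 with Rem. 1.24 and Def. 2.9; Friedli–Velenik 2017,
§6.10.1). [folklore] -/
theorem isSpecification_and_isGibbsMeasure_perturbedMeasure [MeasurableSingletonClass G] (β : ℝ)
    (W : QuasiLocalGaugePerturbation d Lt G b) :
    IsSpecification (fun (Λ : Finset (Edge d Lt)) (ζ : GaugeConfig d Lt G) =>
        ((Measure.pi fun _ : ↥Λ => haarProbability G).map (glueWith Λ · ζ)).tilted
          fun U => -β * wilsonAction ρ U - W.total U) ∧
      IsGibbsMeasure (fun (Λ : Finset (Edge d Lt)) (ζ : GaugeConfig d Lt G) =>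
        ((Measure.pi fun _ : ↥Λ => haarProbability G).map (glueWith Λ · ζ)).tilted
          fun U => -β * wilsonAction ρ U - W.total U) (W.perturbedMeasure ρ β) := by
  have hspec : IsSpecification (fun (Λ : Finset (Edge d Lt)) (ζ : GaugeConfig d Lt G) =>
      ((Measure.pi fun _ : ↥Λ => haarProbability G).map (glueWith Λ · ζ)).tilted
        fun U => -β * wilsonAction ρ U - W.total U) :=
    isSpecification_tilted_map_glueWith_pi (haarProbability G)
      (φ := fun _ U => -β * wilsonAction ρ U - W.total U)
      (fun _ => measurable_action ρ hρ β W) (fun _ => exists_abs_action_le ρ hρ β W)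
      (fun _ _ _ _ _ _ => by simp only [sub_self])
  refine ⟨hspec, ?_⟩
  have huniv := hspec.isGibbsMeasure_univ (1 : GaugeConfig d Lt G)
  rwa [map_glueWith_univ_pi, ← perturbedMeasure_eq_tilted ρ hρ β W] at huniv

/-- **Two-sided density continuity of the perturbed kernels in `W`**: `‖W - W'‖_{b,κ} ≤ δ` with
`κ ≥ 0` gives, for the same exterior and every `[0,1]`-valued measurable `f` on a region `Λ` of
links of the blocks `R ⊆ blockCorners b`, kernel expectations within the factor `e^{2δ|R|}` both
ways: two tilts of one glued product Haar measure by energies differing by `(W' - W).total`, which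
oscillates by at most `δ|R|` in the glued variables (`exists_abs_total_glueWith_sub_le`,
`integral_glued_tilted_le_exp_mul`). [folklore] -/
theorem integral_kernel_le_exp_mul_of_normLE_sub (β : ℝ)
    (W W' : QuasiLocalGaugePerturbation d Lt G b) {κ δ : ℝ} (hκ : 0 ≤ κ) (hW : (W - W').NormLE κ δ)
    {R : Finset (Site d Lt)} (hR : R ⊆ blockCorners b) {Λ : Finset (Edge d Lt)}
    (hΛ : ∀ e ∈ Λ, blockCorner b e.1 ∈ R) (ζ : GaugeConfig d Lt G) {f : GaugeConfig d Lt G → ℝ}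
    (hf : Measurable f) (hf01 : ∀ U, 0 ≤ f U ∧ f U ≤ 1) :
    ∫ U, f U ∂(((Measure.pi fun _ : ↥Λ => haarProbability G).map (glueWith Λ · ζ)).tilted
        fun U => -β * wilsonAction ρ U - W.total U) ≤ Real.exp (2 * δ * R.card) *
      ∫ U, f U ∂(((Measure.pi fun _ : ↥Λ => haarProbability G).map (glueWith Λ · ζ)).tilted
        fun U => -β * wilsonAction ρ U - W'.total U) ∧
    ∫ U, f U ∂(((Measure.pi fun _ : ↥Λ => haarProbability G).map (glueWith Λ · ζ)).tilted
        fun U => -β * wilsonAction ρ U - W'.total U) ≤ Real.exp (2 * δ * R.card) *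
      ∫ U, f U ∂(((Measure.pi fun _ : ↥Λ => haarProbability G).map (glueWith Λ · ζ)).tilted
        fun U => -β * wilsonAction ρ U - W.total U) := by
  obtain ⟨c, hc⟩ := exists_abs_total_glueWith_sub_le (W - W') hκ hW hR hΛ ζ
  have hsub : ∀ U, (W - W').total U = W.total U - W'.total U := fun U => by
    simp only [QuasiLocalGaugePerturbation.total, QuasiLocalGaugePerturbation.sub_act,
      Finset.sum_sub_distrib]
  rw [show (2 * δ * R.card : ℝ) = 2 * (δ * R.card) from mul_assoc _ _ _]
  constructor
  · refine integral_glued_tilted_le_exp_mul (haarProbability G) Λ ζ ζ (measurable_action ρ hρ β W)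
      (measurable_action ρ hρ β W') (exists_abs_action_le ρ hρ β W) (exists_abs_action_le ρ hρ β W')
      hf hf01 (fun _ => rfl) (c := -c) fun u => ?_
    calc |(-β * wilsonAction ρ (glueWith Λ u ζ) - W.total (glueWith Λ u ζ)) -
          (-β * wilsonAction ρ (glueWith Λ u ζ) - W'.total (glueWith Λ u ζ)) - (-c)|
        = |(W - W').total (glueWith Λ u ζ) - c| := by rw [hsub, ← abs_neg]; congr 1; ring
      _ ≤ δ * R.card := hc u
  · refine integral_glued_tilted_le_exp_mul (haarProbability G) Λ ζ ζ (measurable_action ρ hρ β W')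
      (measurable_action ρ hρ β W) (exists_abs_action_le ρ hρ β W') (exists_abs_action_le ρ hρ β W)
      hf hf01 (fun _ => rfl) (c := c) fun u => ?_
    calc |(-β * wilsonAction ρ (glueWith Λ u ζ) - W'.total (glueWith Λ u ζ)) -
          (-β * wilsonAction ρ (glueWith Λ u ζ) - W.total (glueWith Λ u ζ)) - c|
        = |(W - W').total (glueWith Λ u ζ) - c| := by rw [hsub]; congr 1; ring
      _ ≤ δ * R.card := hc u

/-- **Quasi-locality of the perturbed kernels in the exterior**: under `‖W‖_{b,κ} ≤ η` (`κ ≥ 0`),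
range control (a polymer with a non-vanishing activity has coordinate extent `≤ b|X|`) and `b ≥ 1`,
two exteriors agreeing on every link whose block is `(m+1)`-near `R` give kernel expectations within
the factor `exp(4 η e^{-κ m} |R|)` for every `[0,1]`-valued measurable `f` reading only links of `Λ`
and links where the exteriors agree: the Wilson parts of the two pulled-back energies differ by a
constant in the glued variables (`wilsonAction_glueWith_sub_eq`), the `W`-parts by a constant up to
`2 η e^{-κ(m+2)} |R| ≤ 2 η e^{-κ m} |R|` (`exists_abs_total_glueWith_sub_sub_le`). [folklore] -/
theorem integral_kernel_le_exp_mul_of_exterior_eq (hb : 1 ≤ b) (β : ℝ)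
    (W : QuasiLocalGaugePerturbation d Lt G b) {κ η : ℝ} (hκ : 0 ≤ κ) (hW : W.NormLE κ η)
    (hRC : ∀ X : Finset (Site d Lt), X ∈ polymers b → (∃ U : GaugeConfig d Lt G, W.act X U ≠ 0) →
      ∀ y ∈ X, ∀ y' ∈ X, ∀ i : Fin d, (y i - y' i).val ≤ b * X.card ∨ (y' i - y i).val ≤ b * X.card)
    {R : Finset (Site d Lt)} (hR : R ⊆ blockCorners b) {Λ : Finset (Edge d Lt)}
    (hΛ : ∀ e ∈ Λ, blockCorner b e.1 ∈ R) (m : ℕ) {ζ ζ' : GaugeConfig d Lt G}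
    (hζ : ∀ e : Edge d Lt, (∃ y ∈ R, ∀ i, (y i - blockCorner b e.1 i).val ≤ b * (m + 1) ∨
      (blockCorner b e.1 i - y i).val ≤ b * (m + 1)) → ζ e = ζ' e)
    {f : GaugeConfig d Lt G → ℝ} (hf : Measurable f) (hf01 : ∀ U, 0 ≤ f U ∧ f U ≤ 1)
    (hdep : DependsOn f {e : Edge d Lt | e ∈ Λ ∨ ζ e = ζ' e}) :
    ∫ U, f U ∂(((Measure.pi fun _ : ↥Λ => haarProbability G).map (glueWith Λ · ζ)).tilted
        fun U => -β * wilsonAction ρ U - W.total U) ≤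
      Real.exp (4 * (η * Real.exp (-(κ * m))) * R.card) *
        ∫ U, f U ∂(((Measure.pi fun _ : ↥Λ => haarProbability G).map (glueWith Λ · ζ')).tilted
          fun U => -β * wilsonAction ρ U - W.total U) := by
  obtain ⟨c, hc⟩ := exists_abs_total_glueWith_sub_sub_le W hκ hW hRC hR hΛ m hζ
  let u₀ : Λ → G := fun _ => 1
  have hfζ : ∀ u : Λ → G, f (glueWith Λ u ζ) = f (glueWith Λ u ζ') := fun u =>
    hdep fun e he => by
      by_cases heΛ : e ∈ Λ
      · rw [glueWith_apply_mem _ _ _ heΛ, glueWith_apply_mem _ _ _ heΛ]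
      · rw [glueWith_apply_not_mem _ _ _ heΛ, glueWith_apply_not_mem _ _ _ heΛ]
        exact he.resolve_left heΛ
  have hmain := integral_glued_tilted_le_exp_mul (haarProbability G) Λ ζ ζ'
    (measurable_action ρ hρ β W) (measurable_action ρ hρ β W) (exists_abs_action_le ρ hρ β W)
    (exists_abs_action_le ρ hρ β W) hf hf01 hfζ
    (c := -β * (wilsonAction ρ (glueWith Λ u₀ ζ) - wilsonAction ρ (glueWith Λ u₀ ζ')) - c)
    (ε := 2 * (η * Real.exp (-(κ * (m + 2)))) * R.card) fun u => by
      have hS := wilsonAction_glueWith_sub_eq ρ hb hΛ (Nat.succ_le_succ (Nat.zero_le m)) hζ u u₀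
      have hrw : (-β * wilsonAction ρ (glueWith Λ u ζ) - W.total (glueWith Λ u ζ)) -
          (-β * wilsonAction ρ (glueWith Λ u ζ') - W.total (glueWith Λ u ζ')) -
          (-β * (wilsonAction ρ (glueWith Λ u₀ ζ) - wilsonAction ρ (glueWith Λ u₀ ζ')) - c) =
          -(W.total (glueWith Λ u ζ) - W.total (glueWith Λ u ζ') - c) := by
        rw [← hS]; ring
      rw [hrw, abs_neg]
      exact hc u
  refine hmain.trans (mul_le_mul_of_nonneg_right ?_ (integral_nonneg fun U => (hf01 U).1))
  rw [Real.exp_le_exp]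
  have hη : 0 ≤ η := hW.nonneg
  have hexp : Real.exp (-(κ * (m + 2))) ≤ Real.exp (-(κ * m)) := Real.exp_le_exp.2 (by nlinarith)
  have hRc : (0 : ℝ) ≤ R.card := Nat.cast_nonneg _
  nlinarith [mul_le_mul_of_nonneg_right (mul_le_mul_of_nonneg_left hexp hη) hRc]

end QuasiLocalGaugePerturbation

end Kernels

end Literature.MathematicalPhysics.QuantumFieldTheory

end
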